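import Summits.ResolutionOfSingularities.ResolutionOfSingularities.Theorems.FrobeniusLadderFInjectiveMacaulayficationT11SpecimenDoorGeneric
import HarnessLib

/-!
# THE SPECIMEN DOOR FOR `T₁₁⁺` IN EVERY CHARACTERISTIC `p ∉ {2, 3, 7}` — characteristic `11` included
# (crux `FrobeniusLadder.FInjectiveMacaulayfication` stmt-ResolutionOfSingularities-15315, chain w45a, road B; sequel to `T11SpecimenDoorGeneric` (p528895);
# seat res-L1-w45a-stub-2)

[OURS · L1 W4.5a] AI-written; AI review is weaker than expert review. NOT a statement of any manuscript; no named fact.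

`T11SpecimenDoorGeneric` proves that `T₁₁⁺ = V(Φ − y² − x³, z² + Φ³ + x¹¹ + w⁷) ⊂ 𝔸⁵` is regular off the origin when `2, 3, 7, 11 ≠ 0` in `k`; the
hypothesis `11 ≠ 0` was used only to get `x ∈ P` from the `x`-minor `−9x²Φ² − 11x¹⁰` once `Φ ∈ P`. That step has a coefficient-free
replacement — `x¹¹ = F₁ − z² − Φ³ − w⁷ ∈ P` — so the same four minors work for EVERY `p ∉ {2, 3, 7}` (at `p = 7` the `w`-minor `7w⁶` vanishes
and the far F-pure circle of `T11PlusOffStratum` appears; `p = 2, 3` kill the `z`- and `y`-minors). Hence T₁₁/11 is a cells-only campaign too: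

* `exists_det_not_mem` — some minor `∉ P` for `P ⊇ (F₀,F₁)` prime missing a variable, `2, 3, 7 ≠ 0`;
* `t11Plus_hoff_of_ne` — the `hoff` binder of the generic specimen door, any prime `p ∉ {2, 3, 7}`;
* `fInjectiveMacaulayfication_T11plus_of_ne` — **THE DOOR for `p ∉ {2, 3, 7}`** (crux conclusion for `T₁₁⁺/k` modulo `h0` = `PFix_p` at the origin);
* `fInjectiveMacaulayfication_T11plus_char11_of_h0`, `…_char13_of_h0` — the instances `p = 11`, `p = 13` (the remaining brief primes).

No definitions, no named facts. [cite: Matsumura1987, Thm. 30.4 (ii), Thm. 14.2, Thm. 17.4, Thm. 21.2]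
-/

set_option linter.dupNamespace false

noncomputable section

namespace Summit.ResolutionOfSingularities.ResolutionOfSingularities.Theorems.FInjectiveMacaulayfication.T11SpecimenDoorWide

open MvPolynomial AlgebraicGeometry
open Summit.ResolutionOfSingularities.ResolutionOfSingularities.Theorems.FInjectiveMacaulayfication

variable {k : Type} [Field k]

/-! ## §1 Off the origin some minor is a unit, `2, 3, 7 ≠ 0` only -/

/-- **Off the origin, one of the four minors is not in `P`** (`P ⊇ (F₀, F₁)` prime, some variable `∉ P`), provided only `2, 3, 7 ≠ 0` in `k`:
the `Φ ∈ P` branches use `x¹¹ = F₁ − z² − Φ³ − w⁷ ∈ P` instead of the coefficient `11` of `T11SpecimenDoorGeneric.exists_det_not_mem`. [folklore] -/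
theorem exists_det_not_mem (h2 : (2 : k) ≠ 0) (h3 : (3 : k) ≠ 0) (h7 : (7 : k) ≠ 0) (Fs : Fin 2 → MvPolynomial (Fin 5) k)
    (hF₀ : Fs 0 = X 4 - X 1 ^ 2 - X 0 ^ 3) (hF₁ : Fs 1 = X 2 ^ 2 + X 4 ^ 3 + X 0 ^ 11 + X 3 ^ 7)
    (P : Ideal (MvPolynomial (Fin 5) k)) [hP : P.IsPrime] (hF₀P : Fs 0 ∈ P) (hF₁P : Fs 1 ∈ P)
    (hj : ∃ j : Fin 5, (X j : MvPolynomial (Fin 5) k) ∉ P) :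
    ∃ D : Fin 2 → Derivation ℤ (MvPolynomial (Fin 5) k) (MvPolynomial (Fin 5) k), (Matrix.of fun i j => D i (Fs j)).det ∉ P := by
  by_contra hcon
  push Not at hcon
  have hz : (X 2 : MvPolynomial (Fin 5) k) ∈ P := by
    have h := hcon ![(pderiv 2).restrictScalars ℤ, (pderiv 4).restrictScalars ℤ]
    rw [T11SpecimenDoorGeneric.det_z Fs hF₀ hF₁] at h
    exact ((hP.mem_or_mem h).resolve_left (T11SpecimenDoorGeneric.C_not_mem hP.ne_top (neg_ne_zero.mpr h2)))
  have hw : (X 3 : MvPolynomial (Fin 5) k) ∈ P := by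
    have h := hcon ![(pderiv 3).restrictScalars ℤ, (pderiv 4).restrictScalars ℤ]
    rw [T11SpecimenDoorGeneric.det_w Fs hF₀ hF₁] at h
    exact hP.mem_of_pow_mem 6 ((hP.mem_or_mem h).resolve_left (T11SpecimenDoorGeneric.C_not_mem hP.ne_top (neg_ne_zero.mpr h7)))
  have hyΦ : (X 1 : MvPolynomial (Fin 5) k) ∈ P ∨ (X 4 : MvPolynomial (Fin 5) k) ∈ P := by
    have h := hcon ![(pderiv 1).restrictScalars ℤ, (pderiv 4).restrictScalars ℤ]
    rw [T11SpecimenDoorGeneric.det_y Fs hF₀ hF₁] at h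
    have h6 : (-6 : k) ≠ 0 := by
      rw [neg_ne_zero, show (6 : k) = 2 * 3 by norm_num]
      exact mul_ne_zero h2 h3
    rcases hP.mem_or_mem h with h1 | h1
    · rcases hP.mem_or_mem h1 with h0 | h0
      · exact absurd h0 (T11SpecimenDoorGeneric.C_not_mem hP.ne_top h6)
      · exact Or.inl h0
    · exact Or.inr (hP.mem_of_pow_mem 2 h1)
  have hx' : (C (-9) * X 0 ^ 2 * X 4 ^ 2 + C (-11) * X 0 ^ 10 : MvPolynomial (Fin 5) k) ∈ P := by
    have h := hcon ![(pderiv 0).restrictScalars ℤ, (pderiv 4).restrictScalars ℤ]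
    rwa [T11SpecimenDoorGeneric.det_x Fs hF₀ hF₁] at h
  rcases hyΦ with hy | hΦ
  · -- `y ∈ P`: `Φ ≡ x³`, then `x⁸ (9 + 11 x²) ∈ P` and `x⁹ (1 + x²) ∈ P` force `2 ∈ P`
    by_cases hΦ : (X 4 : MvPolynomial (Fin 5) k) ∈ P
    · -- then all variables are in `P`
      have hx : (X 0 : MvPolynomial (Fin 5) k) ∈ P := by
        -- `x¹¹ = F₁ − z·z − Φ·Φ² − w·w⁶ ∈ P`
        have h11 : (X 0 ^ 11 : MvPolynomial (Fin 5) k) ∈ P := by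
          have : (X 0 ^ 11 : MvPolynomial (Fin 5) k) = Fs 1 - X 2 * X 2 - X 4 * X 4 ^ 2 - X 3 * X 3 ^ 6 := by rw [hF₁]; ring
          rw [this]
          exact sub_mem (sub_mem (sub_mem hF₁P (Ideal.mul_mem_right _ _ hz)) (Ideal.mul_mem_right _ _ hΦ))
            (Ideal.mul_mem_right _ _ hw)
        exact hP.mem_of_pow_mem 11 h11
      obtain ⟨j, hj⟩ := hj
      apply hj
      fin_cases j
      · exact hx
      · exact hy
      · exact hz
      · exact hw
      · exact hΦ
    · have hx : (X 0 : MvPolynomial (Fin 5) k) ∉ P := by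
        intro hx
        apply hΦ
        have : (X 4 : MvPolynomial (Fin 5) k) = Fs 0 + X 1 * X 1 + X 0 * X 0 ^ 2 := by rw [hF₀]; ring
        rw [this]
        exact add_mem (add_mem hF₀P (Ideal.mul_mem_right _ _ hy)) (Ideal.mul_mem_right _ _ hx)
      -- `Φ − x³ ∈ P`
      have hΦx : (X 4 - X 0 ^ 3 : MvPolynomial (Fin 5) k) ∈ P := by
        have : (X 4 - X 0 ^ 3 : MvPolynomial (Fin 5) k) = Fs 0 + X 1 * X 1 := by rw [hF₀]; ring
        rw [this]
        exact add_mem hF₀P (Ideal.mul_mem_right _ _ hy)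
      -- `x⁸ (9 + 11 x²) ∈ P`
      have hA : (X 0 ^ 8 * (C 9 + C 11 * X 0 ^ 2) : MvPolynomial (Fin 5) k) ∈ P := by
        have : (X 0 ^ 8 * (C 9 + C 11 * X 0 ^ 2) : MvPolynomial (Fin 5) k) =
            -(C (-9) * X 0 ^ 2 * X 4 ^ 2 + C (-11) * X 0 ^ 10) - C 9 * X 0 ^ 2 * (X 4 + X 0 ^ 3) * (X 4 - X 0 ^ 3) := by
          simp only [map_neg]
          ring
        rw [this]
        exact sub_mem (neg_mem hx') (Ideal.mul_mem_left _ _ hΦx)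
      have hA' : (C 9 + C 11 * X 0 ^ 2 : MvPolynomial (Fin 5) k) ∈ P :=
        (hP.mem_or_mem hA).resolve_left fun h => hx (hP.mem_of_pow_mem 8 h)
      -- `x⁹ (1 + x²) ∈ P`
      have hB : (X 0 ^ 9 * (1 + X 0 ^ 2) : MvPolynomial (Fin 5) k) ∈ P := by
        have : (X 0 ^ 9 * (1 + X 0 ^ 2) : MvPolynomial (Fin 5) k) =
            Fs 1 - X 2 * X 2 - X 3 * X 3 ^ 6 - (X 4 ^ 2 + X 4 * X 0 ^ 3 + X 0 ^ 6) * (X 4 - X 0 ^ 3) := by rw [hF₁]; ring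
        rw [this]
        exact sub_mem (sub_mem (sub_mem hF₁P (Ideal.mul_mem_right _ _ hz)) (Ideal.mul_mem_right _ _ hw))
          (Ideal.mul_mem_left _ _ hΦx)
      have hB' : (1 + X 0 ^ 2 : MvPolynomial (Fin 5) k) ∈ P :=
        (hP.mem_or_mem hB).resolve_left fun h => hx (hP.mem_of_pow_mem 9 h)
      -- `2 = 11 (1 + x²) − (9 + 11 x²)`
      have h2P : (C 2 : MvPolynomial (Fin 5) k) ∈ P := by
        have : (C 2 : MvPolynomial (Fin 5) k) = C 11 * (1 + X 0 ^ 2) - (C 9 + C 11 * X 0 ^ 2) := by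
          rw [show (2 : k) = 11 - 9 by norm_num, map_sub]
          ring
        rw [this]
        exact sub_mem (Ideal.mul_mem_left _ _ hB') hA'
      exact T11SpecimenDoorGeneric.C_not_mem hP.ne_top h2 h2P
  · -- `Φ ∈ P`: then `x ∈ P` (from the `x`-minor) and `y ∈ P` (from `F₀`), so every variable is in `P`
    have hx : (X 0 : MvPolynomial (Fin 5) k) ∈ P := by
      -- `x¹¹ = F₁ − z·z − Φ·Φ² − w·w⁶ ∈ P`
      have h11 : (X 0 ^ 11 : MvPolynomial (Fin 5) k) ∈ P := by
        have : (X 0 ^ 11 : MvPolynomial (Fin 5) k) = Fs 1 - X 2 * X 2 - X 4 * X 4 ^ 2 - X 3 * X 3 ^ 6 := by rw [hF₁]; ring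
        rw [this]
        exact sub_mem (sub_mem (sub_mem hF₁P (Ideal.mul_mem_right _ _ hz)) (Ideal.mul_mem_right _ _ hΦ))
          (Ideal.mul_mem_right _ _ hw)
      exact hP.mem_of_pow_mem 11 h11
    have hy : (X 1 : MvPolynomial (Fin 5) k) ∈ P := by
      have h : (X 1 ^ 2 : MvPolynomial (Fin 5) k) ∈ P := by
        have : (X 1 ^ 2 : MvPolynomial (Fin 5) k) = X 4 - X 0 * X 0 ^ 2 - Fs 0 := by rw [hF₀]; ring
        rw [this]
        exact sub_mem (sub_mem hΦ (Ideal.mul_mem_right _ _ hx)) hF₀P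
      exact hP.mem_of_pow_mem 2 h
    obtain ⟨j, hj⟩ := hj
    apply hj
    fin_cases j
    · exact hx
    · exact hy
    · exact hz
    · exact hw
    · exact hΦ

/-! ## §2 `hoff` and the door, `p ∉ {2, 3, 7}` -/

/-- **`hoff` FOR `T₁₁⁺`, ANY PRIME `p ∉ {2, 3, 7}`.** [cite: Matsumura1987, Thm. 30.4 (ii) and Thm. 14.2] -/
theorem t11Plus_hoff_of_ne (p : ℕ) [Fact p.Prime] (hp2 : p ≠ 2) (hp3 : p ≠ 3) (hp7 : p ≠ 7) (k : Type) [Field k] [CharP k p]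
    (Fs : Fin 2 → MvPolynomial (Fin 5) k)
    (hF₀ : Fs 0 = X 4 - X 1 ^ 2 - X 0 ^ 3) (hF₁ : Fs 1 = X 2 ^ 2 + X 4 ^ 3 + X 0 ^ 11 + X 3 ^ 7) :
    ∀ (Q : Ideal (MvPolynomial (Fin 5) k ⧸ Ideal.span (Set.range Fs))) [Q.IsMaximal],
      (∃ j : Fin 5, Ideal.Quotient.mk (Ideal.span (Set.range Fs)) (X j) ∉ Q) →
      ∀ d : ℕ, ringKrullDim (Localization.AtPrime Q) = d → ∀ s : Fin d → Localization.AtPrime Q,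
        (Ideal.span (Set.range s)).radical.IsMaximal →
          RingTheory.Sequence.IsWeaklyRegular (Localization.AtPrime Q) (List.ofFn s) ∧
          ∀ y : Localization.AtPrime Q, (∃ e : ℕ, y ^ p ^ e ∈ Ideal.span ((fun z : Localization.AtPrime Q => z ^ p ^ e) ''
            (Ideal.span (Set.range s) : Set (Localization.AtPrime Q)))) → y ∈ Ideal.span (Set.range s) := by
  intro Q hQ hj
  set P := Q.comap (Ideal.Quotient.mk (Ideal.span (Set.range Fs))) with hPdef
  haveI : P.IsPrime := Ideal.comap_isPrime _ _
  have hFP : ∀ l : Fin 2, Fs l ∈ P := fun l => by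
    rw [hPdef, Ideal.mem_comap, Ideal.Quotient.eq_zero_iff_mem.mpr (Ideal.subset_span (Set.mem_range_self l))]
    exact Q.zero_mem
  have hj' : ∃ j : Fin 5, (X j : MvPolynomial (Fin 5) k) ∉ P := by
    obtain ⟨j, hj⟩ := hj
    exact ⟨j, fun h => hj (Ideal.mem_comap.mp h)⟩
  have h2 : (2 : k) ≠ 0 := by exact_mod_cast FcuspOffCurve.natCast_prime_ne_zero_of_charP_ne (k := k) p 2 Nat.prime_two hp2
  have h3 : (3 : k) ≠ 0 := by exact_mod_cast FcuspOffCurve.natCast_prime_ne_zero_of_charP_ne (k := k) p 3 Nat.prime_three hp3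
  have h7 : (7 : k) ≠ 0 := by exact_mod_cast FcuspOffCurve.natCast_prime_ne_zero_of_charP_ne (k := k) p 7 (by norm_num) hp7
  obtain ⟨D, hD⟩ := exists_det_not_mem h2 h3 h7 Fs hF₀ hF₁ P (hFP 0) (hFP 1) hj'
  exact (CIJacobian.ci_clause_of_det_not_mem p k 5 2 Fs Q D hD).2.2.1

/-- **THE SPECIMEN DOOR FOR `T₁₁⁺`, ANY PRIME `p ∉ {2, 3, 7}`, MODULO POINT-FIXABILITY AT THE ORIGIN** (as `T11SpecimenDoorGeneric.fInjectiveMacaulayfication_T11plus_of_ne`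
without the hypothesis `p ≠ 11`). [folklore assembly] -/
theorem fInjectiveMacaulayfication_T11plus_of_ne (p : ℕ) [Fact p.Prime] (hp2 : p ≠ 2) (hp3 : p ≠ 3) (hp7 : p ≠ 7)
    (k : Type) [Field k] [CharP k p] (Fs : Fin 2 → MvPolynomial (Fin 5) k)
    (hF₀ : Fs 0 = X 4 - X 1 ^ 2 - X 0 ^ 3) (hF₁ : Fs 1 = X 2 ^ 2 + X 4 ^ 3 + X 0 ^ 11 + X 3 ^ 7)
    (h0 : ∀ b : Spec (.of (MvPolynomial (Fin 5) k ⧸ Ideal.span (Set.range Fs))),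
      b.asIdeal = Ideal.span (Set.range fun j : Fin 5 => Ideal.Quotient.mk (Ideal.span (Set.range Fs)) (X j)) →
      ∃ (m : ℕ) (c : Fin m → (Spec (.of (MvPolynomial (Fin 5) k ⧸ Ideal.span (Set.range Fs)))).presheaf.stalk b),
        Ideal.span (Set.range c) ≠ ⊥ ∧
        (Ideal.span (Set.range c)).radical =
          IsLocalRing.maximalIdeal ((Spec (.of (MvPolynomial (Fin 5) k ⧸ Ideal.span (Set.range Fs)))).presheaf.stalk b) ∧
        ∀ (j : Fin m) (𝔔 : PrimeSpectrum (Literature.AlgebraicGeometry.Resolution.blowupAlgebra (Ideal.span (Set.range c)) (c j))),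
          𝔔.asIdeal.comap (algebraMap ((Spec (.of (MvPolynomial (Fin 5) k ⧸ Ideal.span (Set.range Fs)))).presheaf.stalk b)
            (Literature.AlgebraicGeometry.Resolution.blowupAlgebra (Ideal.span (Set.range c)) (c j))) =
            IsLocalRing.maximalIdeal ((Spec (.of (MvPolynomial (Fin 5) k ⧸ Ideal.span (Set.range Fs)))).presheaf.stalk b) →
          IsDomain (Localization.AtPrime 𝔔.asIdeal) ∧ ∀ d : ℕ, ringKrullDim (Localization.AtPrime 𝔔.asIdeal) = d →
            ∀ s : Fin d → Localization.AtPrime 𝔔.asIdeal, (Ideal.span (Set.range s)).radical.IsMaximal →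
              RingTheory.Sequence.IsWeaklyRegular (Localization.AtPrime 𝔔.asIdeal) (List.ofFn s) ∧
              ∀ y : Localization.AtPrime 𝔔.asIdeal, (∃ e : ℕ, y ^ p ^ e ∈
                Ideal.span ((fun z : Localization.AtPrime 𝔔.asIdeal => z ^ p ^ e) ''
                  (Ideal.span (Set.range s) : Set (Localization.AtPrime 𝔔.asIdeal)))) → y ∈ Ideal.span (Set.range s)) :
    ∃ (X' : Scheme.{0}) (π : X' ⟶ (Spec (.of (MvPolynomial (Fin 5) k ⧸ Ideal.span (Set.range Fs))))), IsProper π ∧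
      Literature.AlgebraicGeometry.Resolution.IsBirational π ∧
      ∀ x : X', IsDomain (X'.presheaf.stalk x) ∧ ∀ d : ℕ, ringKrullDim (X'.presheaf.stalk x) = d →
        ∀ s : Fin d → X'.presheaf.stalk x, (Ideal.span (Set.range s)).radical.IsMaximal →
          RingTheory.Sequence.IsWeaklyRegular (X'.presheaf.stalk x) (List.ofFn s) ∧
          ∀ y : X'.presheaf.stalk x, (∃ e : ℕ, y ^ p ^ e ∈
            Ideal.span ((fun z : X'.presheaf.stalk x => z ^ p ^ e) '' (Ideal.span (Set.range s) : Set (X'.presheaf.stalk x)))) →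
            y ∈ Ideal.span (Set.range s) := by
  obtain ⟨hprime, -⟩ := T11PlusPrime.t11plus_prime_and_X_ne_zero k Fs hF₀ hF₁
  exact SpecimenDoor.fInjectiveMacaulayfication_of_originPointFixable p Fact.out k 5 2 Fs hprime
    (QuotientOriginMaximal.isMaximal_span_range_mk_X k Fs (T11SpecimenDoorGeneric.constantCoeff_eq_zero Fs hF₀ hF₁))
    (t11Plus_hoff_of_ne p hp2 hp3 hp7 k Fs hF₀ hF₁)
    (fun Q hQ => T11SpecimenDoor.cmClause_of_isMaximal (Fs 0) (Fs 1) hF₀ hF₁ (Set.range Fs) (T11SpecimenDoorGeneric.range_eq_list Fs) Q hQ) h0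

/-- **THE SPECIMEN DOOR FOR `T₁₁⁺` AT `p = 11`**: the crux conclusion for `X = T₁₁⁺/k`, `char k = 11`, modulo `h0` = `PFix_11` at the origin. [folklore assembly] -/
theorem fInjectiveMacaulayfication_T11plus_char11_of_h0 (k : Type) [Field k] [CharP k 11] (Fs : Fin 2 → MvPolynomial (Fin 5) k)
    (hF₀ : Fs 0 = X 4 - X 1 ^ 2 - X 0 ^ 3) (hF₁ : Fs 1 = X 2 ^ 2 + X 4 ^ 3 + X 0 ^ 11 + X 3 ^ 7)
    (h0 : ∀ b : Spec (.of (MvPolynomial (Fin 5) k ⧸ Ideal.span (Set.range Fs))),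
      b.asIdeal = Ideal.span (Set.range fun j : Fin 5 => Ideal.Quotient.mk (Ideal.span (Set.range Fs)) (X j)) →
      ∃ (m : ℕ) (c : Fin m → (Spec (.of (MvPolynomial (Fin 5) k ⧸ Ideal.span (Set.range Fs)))).presheaf.stalk b),
        Ideal.span (Set.range c) ≠ ⊥ ∧
        (Ideal.span (Set.range c)).radical =
          IsLocalRing.maximalIdeal ((Spec (.of (MvPolynomial (Fin 5) k ⧸ Ideal.span (Set.range Fs)))).presheaf.stalk b) ∧
        ∀ (j : Fin m) (𝔔 : PrimeSpectrum (Literature.AlgebraicGeometry.Resolution.blowupAlgebra (Ideal.span (Set.range c)) (c j))),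
          𝔔.asIdeal.comap (algebraMap ((Spec (.of (MvPolynomial (Fin 5) k ⧸ Ideal.span (Set.range Fs)))).presheaf.stalk b)
            (Literature.AlgebraicGeometry.Resolution.blowupAlgebra (Ideal.span (Set.range c)) (c j))) =
            IsLocalRing.maximalIdeal ((Spec (.of (MvPolynomial (Fin 5) k ⧸ Ideal.span (Set.range Fs)))).presheaf.stalk b) →
          IsDomain (Localization.AtPrime 𝔔.asIdeal) ∧ ∀ d : ℕ, ringKrullDim (Localization.AtPrime 𝔔.asIdeal) = d →
            ∀ s : Fin d → Localization.AtPrime 𝔔.asIdeal, (Ideal.span (Set.range s)).radical.IsMaximal →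
              RingTheory.Sequence.IsWeaklyRegular (Localization.AtPrime 𝔔.asIdeal) (List.ofFn s) ∧
              ∀ y : Localization.AtPrime 𝔔.asIdeal, (∃ e : ℕ, y ^ 11 ^ e ∈
                Ideal.span ((fun z : Localization.AtPrime 𝔔.asIdeal => z ^ 11 ^ e) ''
                  (Ideal.span (Set.range s) : Set (Localization.AtPrime 𝔔.asIdeal)))) → y ∈ Ideal.span (Set.range s)) :
    ∃ (X' : Scheme.{0}) (π : X' ⟶ (Spec (.of (MvPolynomial (Fin 5) k ⧸ Ideal.span (Set.range Fs))))), IsProper π ∧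
      Literature.AlgebraicGeometry.Resolution.IsBirational π ∧
      ∀ x : X', IsDomain (X'.presheaf.stalk x) ∧ ∀ d : ℕ, ringKrullDim (X'.presheaf.stalk x) = d →
        ∀ s : Fin d → X'.presheaf.stalk x, (Ideal.span (Set.range s)).radical.IsMaximal →
          RingTheory.Sequence.IsWeaklyRegular (X'.presheaf.stalk x) (List.ofFn s) ∧
          ∀ y : X'.presheaf.stalk x, (∃ e : ℕ, y ^ 11 ^ e ∈
            Ideal.span ((fun z : X'.presheaf.stalk x => z ^ 11 ^ e) '' (Ideal.span (Set.range s) : Set (X'.presheaf.stalk x)))) →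
            y ∈ Ideal.span (Set.range s) :=
  haveI : Fact (Nat.Prime 11) := ⟨by norm_num⟩
  fInjectiveMacaulayfication_T11plus_of_ne 11 (by norm_num) (by norm_num) (by norm_num) k Fs hF₀ hF₁ h0

/-- **THE SPECIMEN DOOR FOR `T₁₁⁺` AT `p = 13`**: the crux conclusion for `X = T₁₁⁺/k`, `char k = 13`, modulo `h0` = `PFix_13` at the origin. [folklore assembly] -/
theorem fInjectiveMacaulayfication_T11plus_char13_of_h0 (k : Type) [Field k] [CharP k 13] (Fs : Fin 2 → MvPolynomial (Fin 5) k)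
    (hF₀ : Fs 0 = X 4 - X 1 ^ 2 - X 0 ^ 3) (hF₁ : Fs 1 = X 2 ^ 2 + X 4 ^ 3 + X 0 ^ 11 + X 3 ^ 7)
    (h0 : ∀ b : Spec (.of (MvPolynomial (Fin 5) k ⧸ Ideal.span (Set.range Fs))),
      b.asIdeal = Ideal.span (Set.range fun j : Fin 5 => Ideal.Quotient.mk (Ideal.span (Set.range Fs)) (X j)) →
      ∃ (m : ℕ) (c : Fin m → (Spec (.of (MvPolynomial (Fin 5) k ⧸ Ideal.span (Set.range Fs)))).presheaf.stalk b),
        Ideal.span (Set.range c) ≠ ⊥ ∧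
        (Ideal.span (Set.range c)).radical =
          IsLocalRing.maximalIdeal ((Spec (.of (MvPolynomial (Fin 5) k ⧸ Ideal.span (Set.range Fs)))).presheaf.stalk b) ∧
        ∀ (j : Fin m) (𝔔 : PrimeSpectrum (Literature.AlgebraicGeometry.Resolution.blowupAlgebra (Ideal.span (Set.range c)) (c j))),
          𝔔.asIdeal.comap (algebraMap ((Spec (.of (MvPolynomial (Fin 5) k ⧸ Ideal.span (Set.range Fs)))).presheaf.stalk b)
            (Literature.AlgebraicGeometry.Resolution.blowupAlgebra (Ideal.span (Set.range c)) (c j))) =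
            IsLocalRing.maximalIdeal ((Spec (.of (MvPolynomial (Fin 5) k ⧸ Ideal.span (Set.range Fs)))).presheaf.stalk b) →
          IsDomain (Localization.AtPrime 𝔔.asIdeal) ∧ ∀ d : ℕ, ringKrullDim (Localization.AtPrime 𝔔.asIdeal) = d →
            ∀ s : Fin d → Localization.AtPrime 𝔔.asIdeal, (Ideal.span (Set.range s)).radical.IsMaximal →
              RingTheory.Sequence.IsWeaklyRegular (Localization.AtPrime 𝔔.asIdeal) (List.ofFn s) ∧
              ∀ y : Localization.AtPrime 𝔔.asIdeal, (∃ e : ℕ, y ^ 13 ^ e ∈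
                Ideal.span ((fun z : Localization.AtPrime 𝔔.asIdeal => z ^ 13 ^ e) ''
                  (Ideal.span (Set.range s) : Set (Localization.AtPrime 𝔔.asIdeal)))) → y ∈ Ideal.span (Set.range s)) :
    ∃ (X' : Scheme.{0}) (π : X' ⟶ (Spec (.of (MvPolynomial (Fin 5) k ⧸ Ideal.span (Set.range Fs))))), IsProper π ∧
      Literature.AlgebraicGeometry.Resolution.IsBirational π ∧
      ∀ x : X', IsDomain (X'.presheaf.stalk x) ∧ ∀ d : ℕ, ringKrullDim (X'.presheaf.stalk x) = d →
        ∀ s : Fin d → X'.presheaf.stalk x, (Ideal.span (Set.range s)).radical.IsMaximal →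
          RingTheory.Sequence.IsWeaklyRegular (X'.presheaf.stalk x) (List.ofFn s) ∧
          ∀ y : X'.presheaf.stalk x, (∃ e : ℕ, y ^ 13 ^ e ∈
            Ideal.span ((fun z : X'.presheaf.stalk x => z ^ 13 ^ e) '' (Ideal.span (Set.range s) : Set (X'.presheaf.stalk x)))) →
            y ∈ Ideal.span (Set.range s) :=
  haveI : Fact (Nat.Prime 13) := ⟨by norm_num⟩
  fInjectiveMacaulayfication_T11plus_of_ne 13 (by norm_num) (by norm_num) (by norm_num) k Fs hF₀ hF₁ h0

end Summit.ResolutionOfSingularities.ResolutionOfSingularities.Theorems.FInjectiveMacaulayfication.T11SpecimenDoorWide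

end
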